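import Summits.BirchSwinnertonDyer.BirchSwinnertonDyer.Theorems.ByReductionTypeAtTwoOrdKatoHalfAtTwoIsoZetaColemanMuSelmerSideLocTwo
import Summits.BirchSwinnertonDyer.BirchSwinnertonDyer.Theorems.ByReductionTypeAtTwoOrdKatoHalfAtTwoIsoSignFreeDefs
import HarnessLib

/-!
# Route ByReductionTypeAtTwo, crux `OrdKatoHalfAtTwoIso` (stmt-BirchSwinnertonDyer-19573), line
# `steinberg-fibre-at-two`, child F1μ⁺ `OrdKatoFineZetaAtTwoResidue` (stmt-BirchSwinnertonDyer-23959 =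
# `SteinbergFibreAtTwo.ZetaColemanMuInputsAtTwo`, SIGN-FREE): the ∀-supply doors BY NAME in the shape the typed inputs
# take — (L) local Coleman dual pair at `2`, (R) reciprocity on Kato's classes, (E) the explicit-reciprocity-law SHAPE
# `col (ℓ₀ g) = u·M̃·L′`, `ι L′ = ϖ′·L₂(f, α)`, `‖ϖ′‖₂ = 1`, `M̃ ∉ (2)` — and the algebra turning that shape into the
# one-class image clause at `(2)`

Seat `cruxlead-stmt-BirchSwinnertonDyer-19573-w3` g2 (prover WIDTH under the LEAD `cruxlead-19573` g5; HOME
`run/shared/lean/pub/bsd-2adic/`; `--supports` stmt-BirchSwinnertonDyer-23959 `OrdKatoFineZetaAtTwoResidue`, the P7 sign-free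
re-cut of 23760/23890). HONEST FRAMING (cell bsd-2adic): BSD is not proved by any of this; F1μ⁺ and the crux are NOT proved
here; every theorem below is a KERNEL implication over explicit hypotheses — no definition, no named fact, no `sorry`.

WHY THIS FILE. After w3 g0 (p682177 Selmer side; p683151 `μ`(Kato's `Λ`-adic multiplier) `= 0` at `2`; p685098 finite-kernel
road; p686000 `ker loc₂|_{Sel} = Sel₀` kernel) and the lead's P7 re-cut (p684479: the F1 child is now the SIGN-FREE
`ZetaColemanMuInputsAtTwo`), the beyond-print content of the F1 child is, per datum, exactly three typed inputs over a set
`G ⊆ 𝐇¹_Γ(T₂W)` of GENUINE `2`-adic Euler-system classes: **F1-Col/F1-Dual** = (L) a local Coleman dual pair at `2`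
(`IsDualPair 2 ψ toDualP` on a `Λ`-module `P₀` against an abelian group `S` — in print `S = H¹_f(ℚ_{∞,2}, E[2^∞])`,
`P₀ = 𝐇¹_loc(T)/𝐇¹_loc(T')` — with an injective, or finite-kernel, `Λ`-linear `col : P₀ → Λ`, Kato 17.9/17.11/17.12 at `2`,
and `φ = loc₂` on `Sel_{2^∞}(E/ℚ_∞)`), **F1-R** = (R) `toDualP (ℓ₀ g) (φ s) = 0` (Poitou–Tate; no archimedean term for
either sign of `Δ`, the tree's Selmer groups being strict at `∞`), **F1-ERLμ** = (E) Kato 16.6 (2) + 13.10 (1) + 17.5 at `2`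
WITHOUT a `2`-power: `col (ℓ₀ z_{c,d,a(A)}) = u·M̃·L′` with `u ∈ Λˣ`, `M̃` the `Λ`-adic multiplier (`∉ (2)`, p683151),
`ι L′ = ϖ′·L₂(f, α)` for the period ratio `ϖ′` — a `2`-adic unit by Abbes–Ullmo on `Δ < 0` (p654400) and by the MEMO-6
reading on `0 < Δ`. This file supplies:

* §1 the ALGEBRA of F1-ERLμ (`exists_not_mem_augIdealP_and_eq_mul_of_erlShape`): from `x = u·M·L′`, `ι L′ = C r · L`,
  `‖r‖₂ = 1`, `M ∉ (2)` and ANY integral `G₁` with `ι G₁ = L`, get `s ∉ (2)` with `x = s·G₁` (`ι : Λ ↪ ℚ₂⟦T⟧` injective,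
  `(2)` prime, units and `C`(unit) outside `(2)`) — so the typed ERL may name ITS OWN integral lift `L′` and period ratio
  `r`, while the doors quantify over every `G₁`;
* §2 per-datum doors with (E) in ERL shape: `hasZetaColemanMuInputsAtTwo_of_localDualPair_locTwo_erl` (injective `col`,
  concludes the per-datum reading) and `mu_eq_zero_of_localDualPair_finiteKer_locTwo_erl` (finite-kernel `col`, `μ = 0` on
  the `Δ < 0` habitat where socket 1 is a theorem);
* §3 the ∀-SUPPLY DOORS concluding **`ZetaColemanMuInputsAtTwo` BY NAME** (= the text of child 23959; `Iff.rfl` bridge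
  `ordKatoFineZetaAtTwoResidue_iff_zetaColemanMuInputsAtTwo`) on the SIGN-FREE habitat «good ordinary at `2`, `ρ̄₂` onto»:
  `zetaColemanMuInputsAtTwo_of_localDualPairs` (abstract (L)(R)(E), the sign-free twin of p682177 §4) and
  `zetaColemanMuInputsAtTwo_of_localDualPairs_locTwo_erl` (generator / `loc₂`-kernel / ERL shape — the shape of the three
  typed inputs), plus `ordKatoFineZetaAtTwoResidue_of_localDualPairs_locTwo_erl` landing on the route child by name.
Nothing here sees the sign of `Δ`: per triage r1-2 s53 the `×2` of Kato §12.1/(14.9.3)/(17.13.1) at `p = 2` is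
sign-coupled and sits in the INPUTS (the unit clause `‖ϖ′‖₂ = 1` on `0 < Δ`, and `col`'s kernel), not in these doors.

References: [Kato2004Asterisque] Thm 12.6 (p. 222), Lemma 13.10 (p. 230), (14.9.3) (p. 240), Thm 16.6 (2) (p. 271), 17.5
(p. 274), Prop 17.11 (p. 277), §17.13 (pp. 279–280); [MazurTateTeitelbaum1986Invent] §I.12–I.13; [AbbesUllmo1996] Thm A;
[GreenbergLNM1716] §2 Prop 2.1; tree p678187, p682177, p683151, p684479, p685098, p686000.
-/

set_option autoImplicit false
set_option linter.dupNamespace false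

noncomputable section

open scoped Classical MatrixGroups ModularForm NumberField
open CongruenceSubgroup WeierstrassCurve Field IsDedekindDomain
open Literature.NumberTheory.GaloisRepresentations
open Literature.NumberTheory.EllipticCurves Literature.NumberTheory.EllipticCurves.ModularForms
  Literature.NumberTheory.EllipticCurves.GreenbergSelmer
open Literature.NumberTheory.EllipticCurves.Kato2004
  Literature.NumberTheory.EllipticCurves.Kato2004.EulerSystemValues
open Literature.NumberTheory.EllipticCurves.IwasawaDual
open Literature.NumberTheory.EllipticCurves.Rank1Residual
open Summit.BirchSwinnertonDyer.Rank1Residual Summit.BirchSwinnertonDyer.Rank1Residual.X5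
open Summit.BirchSwinnertonDyer.BirchSwinnertonDyer.Theses.ByReductionTypeAtTwo

namespace Summit.BirchSwinnertonDyer.BirchSwinnertonDyer.Theorems.SteinbergFibreAtTwo

/-! ## §1 The algebra of the explicit reciprocity law at `(2)`: ERL shape ⇒ one-class image clause -/

section ERL

/-- **F1-ERLμ shape ⇒ image clause, the algebra.** In `Λ = ℤ₂⟦T⟧` with `ι : Λ ↪ ℚ₂⟦T⟧`: if `x = u·M·L′` with `u` a
unit, `M ∉ (2)`, `ι L′ = C r · L` for a `2`-adic UNIT `r` (`‖r‖₂ = 1`), and `G₁ ∈ Λ` is any integral lift of the same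
`L` (`ι G₁ = L`), then `x = s·G₁` for some `s ∉ (2)` — namely `s = u·M·C r`: `ι` is injective so `L′ = C r·G₁`, and
`(2)` is a prime ideal containing no unit. In print: `x = 𝔏(loc z_{c,d,a(A)})`, `M` = Kato's `Λ`-adic multiplier
(Lemma 13.10 (1); `μ(M) = 0`, p683151), `L′ = L_{2-adic,α,ω,γ}` with `γ` good for `T₂E` (Thm 16.6 (2), 17.5),
`r = Ω_γ/Ω⁺_f` the period ratio. [cite: Kato2004Asterisque, Thm 16.6 (2) (p. 271), 17.5 (p. 274), §17.13 (p. 280)]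
[cite: MazurTateTeitelbaum1986Invent, §I.12] -/
theorem exists_not_mem_augIdealP_and_eq_mul_of_erlShape {x M L' G₁ : IwasawaAlgebra 2}
    {u : (IwasawaAlgebra 2)ˣ} {r : ℚ_[2]} {L : PowerSeries ℚ_[2]}
    (hM : M ∉ IwasawaAlgebra.augIdealP 2) (hr : ‖r‖ = 1)
    (hL' : iwasawaToPowerSeries 2 L' = PowerSeries.C r * L) (hG₁ : iwasawaToPowerSeries 2 G₁ = L)
    (hx : x = (u : IwasawaAlgebra 2) * M * L') :
    ∃ s : IwasawaAlgebra 2, s ∉ IwasawaAlgebra.augIdealP 2 ∧ x = s * G₁ := by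
  -- `r` is a `2`-adic integer, indeed a unit
  let r' : ℤ_[2] := ⟨r, hr.le⟩
  have hr' : IsUnit r' := PadicInt.isUnit_iff.2 (by rw [PadicInt.norm_def]; exact hr)
  -- `ι (C r' · G₁) = C r · L = ι L'`, so `L' = C r' · G₁`
  have hLG : L' = PowerSeries.C r' * G₁ := by
    apply iwasawaToPowerSeries_injective 2
    rw [map_mul, hG₁, hL', PowerSeries.map_C]
    rfl
  refine ⟨(u : IwasawaAlgebra 2) * M * PowerSeries.C r', ?_, by rw [hx, hLG]; ring⟩
  intro hmem
  have hP : (IwasawaAlgebra.augIdealP 2).IsPrime := IwasawaAlgebra.isPrime_augIdealP_holds 2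
  rcases hP.mem_or_mem hmem with h₁ | h₂
  · rcases hP.mem_or_mem h₁ with hu | hM'
    · exact hP.ne_top (Ideal.eq_top_of_isUnit_mem _ hu u.isUnit)
    · exact hM hM'
  · exact hP.ne_top (Ideal.eq_top_of_isUnit_mem _ h₂ (hr'.map PowerSeries.C))

/-- **The one-class image clause at `(2)` from the ERL shape on a set of classes.** If some `g ∈ G` has
`col (ℓ₀ g) = u·M·L′` with `u` a unit, `M ∉ (2)`, `ι L′ = C r · L₂(f, α)`, `‖r‖₂ = 1`, then for EVERY integral `G₁` with
`ι G₁ = L₂(f, α)` some `g ∈ G` and `s ∉ (2)` satisfy `col (ℓ₀ g) = s·G₁` — the hypothesis `himgG` of the doors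
`hasZetaColemanMuInputsAtTwo_of_localDualPair_locTwo` / `mu_eq_zero_of_localDualPair_finiteKer_locTwo` (p686000).
[cite: Kato2004Asterisque, Thm 12.6 (p. 222), Thm 16.6 (2) (p. 271), §17.13 (p. 280)] -/
theorem himgG_of_erlShape {H : Type*} [AddCommGroup H] [Module (IwasawaAlgebra 2) H]
    {P₀ : Type*} [AddCommGroup P₀] [Module (IwasawaAlgebra 2) P₀] (G : Set H)
    (col : P₀ →ₗ[IwasawaAlgebra 2] IwasawaAlgebra 2) (ℓ₀ : H →ₗ[IwasawaAlgebra 2] P₀) {L : PowerSeries ℚ_[2]}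
    (herl : ∃ g ∈ G, ∃ (u : (IwasawaAlgebra 2)ˣ) (M L' : IwasawaAlgebra 2) (r : ℚ_[2]),
      M ∉ IwasawaAlgebra.augIdealP 2 ∧ ‖r‖ = 1 ∧ iwasawaToPowerSeries 2 L' = PowerSeries.C r * L ∧
        col (ℓ₀ g) = (u : IwasawaAlgebra 2) * M * L') :
    ∀ G₁ : IwasawaAlgebra 2, iwasawaToPowerSeries 2 G₁ = L →
      ∃ g ∈ G, ∃ s : IwasawaAlgebra 2, s ∉ IwasawaAlgebra.augIdealP 2 ∧ col (ℓ₀ g) = s * G₁ := by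
  intro G₁ hG₁
  obtain ⟨g, hg, u, M, L', r, hM, hr, hL', hcol⟩ := herl
  obtain ⟨s, hs, hsx⟩ := exists_not_mem_augIdealP_and_eq_mul_of_erlShape hM hr hL' hG₁ hcol
  exact ⟨g, hg, s, hs, hsx⟩

end ERL

/-! ## §2 Per datum: the doors with (E) in ERL shape -/

section PerDatum

variable {W : WeierstrassCurve ℚ} [W.IsElliptic] [W.IsGloballyMinimal]
  [ContinuousSMul ℤ_[2] (W.tateModule 2)] [Module.Free ℤ_[2] (W.tateModule 2)]
  [Module.Finite ℤ_[2] (W.tateModule 2)] {N : ℕ} {f : CuspForm (Gamma0 N) 2}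
  {κ : ZpExtension ℚ 2} {γ : absoluteGaloisGroup ℚ} {hκ : κ.IsCyclotomic}

/-- **The per-datum reading from the three typed inputs in their natural shape** (any sign of `Δ`): (L) a local Coleman
dual pair at `2` with INJECTIVE `col` and `φ = loc₂` given by its kernel «restriction to every decomposition group above
`2` vanishes»; (R) reciprocity on the members of `G`; (E) in ERL shape (§1). Composition of p686000
`hasZetaColemanMuInputsAtTwo_of_localDualPair_locTwo` with `himgG_of_erlShape`. Kernel; nothing asserted.
[cite: Kato2004Asterisque, (14.9.3) (p. 240), Thm 16.6 (2) (p. 271), Prop 17.11 (p. 277), §17.13 (pp. 279–280)]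
[cite: GreenbergLNM1716, §2 Prop 2.1 (p. 72)] -/
theorem hasZetaColemanMuInputsAtTwo_of_localDualPair_locTwo_erl (D : W.SelmerDualData κ γ)
    (Y : W.FineSelmerDualData κ γ) (I : IwasawaH1Data W 2 κ γ) (G : Set I.H)
    (hG : ∀ g ∈ G, IsEulerSystemClassTwo W hκ I g)
    {P₀ : Type*} [AddCommGroup P₀] [Module (IwasawaAlgebra 2) P₀] {S : Type*} [AddCommGroup S]
    {ψ : AddMonoid.End S} {toDualP : P₀ →+ (S →+ AddCircle (1 : ℚ))} (hP : IsDualPair 2 ψ toDualP)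
    (col : P₀ →ₗ[IwasawaAlgebra 2] IwasawaAlgebra 2) (hcol : Function.Injective col)
    (φ : W.selmerInfty κ →+ S) (hφ : ∀ s, φ ((W.conjSelmerInfty κ γ - 1) s) = ψ (φ s))
    (hφker : ∀ s : W.selmerInfty κ, φ s = 0 ↔
      ∀ (v : HeightOneSpectrum (𝓞 ℚ)), ((2 : ℕ) : 𝓞 ℚ) ∈ v.asIdeal → ∀ σ : absoluteGaloisGroup ℚ,
        W.conjH1 2 κ.kerSubgroup σ (s : W.subgroupH1 2 κ.kerSubgroup) ∈
          awayKer κ.kerSubgroup (W.geomPrimaryTorsion 2) v)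
    (ℓ₀ : I.H →ₗ[IwasawaAlgebra 2] P₀)
    (hrecG : ∀ g ∈ G, ∀ s : W.selmerInfty κ, toDualP (ℓ₀ g) (φ s) = 0)
    (herl : ∃ g ∈ G, ∃ (u : (IwasawaAlgebra 2)ˣ) (M L' : IwasawaAlgebra 2) (r : ℚ_[2]),
      M ∉ IwasawaAlgebra.augIdealP 2 ∧ ‖r‖ = 1 ∧
        iwasawaToPowerSeries 2 L' = PowerSeries.C r * padicLFunction f (unitRoot W 2 : ℚ_[2]) ∧
        col (ℓ₀ g) = (u : IwasawaAlgebra 2) * M * L') :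
    HasZetaColemanMuInputsAtTwo W f κ γ hκ D Y :=
  hasZetaColemanMuInputsAtTwo_of_localDualPair_locTwo D Y I G hG hP col hcol φ hφ hφker ℓ₀ hrecG
    (himgG_of_erlShape G col ℓ₀ herl)

/-- **`μ(X(E/ℚ_∞)) = 0` from the three typed inputs with a FINITE-KERNEL `col`** (p686000
`mu_eq_zero_of_localDualPair_finiteKer_locTwo` with (E) in ERL shape), for `W` good ordinary at `2`, `ρ̄₂` onto,
`Δ_W < 0` (the half where socket 1 is the theorem `coreTheoremATwoResidue_holds`), any Selmer dual datum `D`. Kernel.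
[cite: Kato2004Asterisque, Thm 16.6 (2) (p. 271), Prop 17.11 (p. 277), §17.13 (pp. 279–280)] [cite: GreenbergLNM1716, §2 Prop 2.1 (p. 72)] -/
theorem mu_eq_zero_of_localDualPair_finiteKer_locTwo_erl [NeZero N] (hgo : GoodOrd W 2)
    (h2 : W.HasSurjectiveModNGaloisRep 2) (hΔ : W.Δ < 0) (hf : IsNewformOf W f) (hγ : κ.IsTopGenerator γ)
    (D : W.SelmerDualData κ γ) (I : IwasawaH1Data W 2 κ γ) (G : Set I.H)
    (hG : ∀ g ∈ G, IsEulerSystemClassTwo W hκ I g)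
    {P₀ : Type*} [AddCommGroup P₀] [Module (IwasawaAlgebra 2) P₀] {S : Type*} [AddCommGroup S]
    {ψ : AddMonoid.End S} {toDualP : P₀ →+ (S →+ AddCircle (1 : ℚ))} (hP : IsDualPair 2 ψ toDualP)
    (col : P₀ →ₗ[IwasawaAlgebra 2] IwasawaAlgebra 2) (hcol : Finite (LinearMap.ker col))
    (φ : W.selmerInfty κ →+ S) (hφ : ∀ s, φ ((W.conjSelmerInfty κ γ - 1) s) = ψ (φ s))
    (hφker : ∀ s : W.selmerInfty κ, φ s = 0 ↔
      ∀ (v : HeightOneSpectrum (𝓞 ℚ)), ((2 : ℕ) : 𝓞 ℚ) ∈ v.asIdeal → ∀ σ : absoluteGaloisGroup ℚ,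
        W.conjH1 2 κ.kerSubgroup σ (s : W.subgroupH1 2 κ.kerSubgroup) ∈
          awayKer κ.kerSubgroup (W.geomPrimaryTorsion 2) v)
    (ℓ₀ : I.H →ₗ[IwasawaAlgebra 2] P₀)
    (hrecG : ∀ g ∈ G, ∀ s : W.selmerInfty κ, toDualP (ℓ₀ g) (φ s) = 0)
    (herl : ∃ g ∈ G, ∃ (u : (IwasawaAlgebra 2)ˣ) (M L' : IwasawaAlgebra 2) (r : ℚ_[2]),
      M ∉ IwasawaAlgebra.augIdealP 2 ∧ ‖r‖ = 1 ∧
        iwasawaToPowerSeries 2 L' = PowerSeries.C r * padicLFunction f (unitRoot W 2 : ℚ_[2]) ∧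
        col (ℓ₀ g) = (u : IwasawaAlgebra 2) * M * L') :
    D.mu = 0 :=
  mu_eq_zero_of_localDualPair_finiteKer_locTwo hgo h2 hΔ hf hγ D I G hG hP col hcol φ hφ hφker ℓ₀ hrecG
    (himgG_of_erlShape G col ℓ₀ herl)

end PerDatum

/-! ## §3 The ∀-supply doors onto `ZetaColemanMuInputsAtTwo` (child 23959) on the sign-free habitat -/

/-- **F1μ⁺ `ZetaColemanMuInputsAtTwo` from a supply of local Coleman dual pairs, curve by curve — abstract (L)(R)(E)**
(the sign-free twin of p682177 `zetaColemanMuInputsNegDiscAtTwo_of_localDualPairs`: the per-datum door never saw the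
sign). For every globally minimal `W`, good ordinary at `2`, `ρ̄_{W,2}` onto, newform `f`, cyclotomic `(κ, γ)`, every Selmer
dual datum `D`: `I`, `Z` inside the span of genuine `2`-adic classes, `(P₀, S, ψ, toDualP)` a dual pair, injective `col`,
`φ` with `ker φ = Sel₀`, `ℓ₀`, reciprocity, image clause. The supply is the OPEN content; nothing asserted.
[cite: Kato2004Asterisque, Thm 12.6 (p. 222), (14.9.3) (p. 240), Thm 16.6 (p. 271), Prop 17.11 (p. 277), §17.13 (pp. 279–280)] -/
theorem zetaColemanMuInputsAtTwo_of_localDualPairs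
    (hsupply : ∀ (W : WeierstrassCurve ℚ) [W.IsElliptic] [W.IsGloballyMinimal]
      [ContinuousSMul ℤ_[2] (W.tateModule 2)] [Module.Free ℤ_[2] (W.tateModule 2)]
      [Module.Finite ℤ_[2] (W.tateModule 2)] {N : ℕ} [NeZero N] (f : CuspForm (Gamma0 N) 2)
      (κ : ZpExtension ℚ 2) (γ : absoluteGaloisGroup ℚ) (hκ : κ.IsCyclotomic),
      IsOrdinaryAt W 2 → W.HasSurjectiveModNGaloisRep 2 →
      κ.IsTopGenerator γ → IsCyclotomicVariable 2 γ → IsNewformOf W f →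
      ∀ (D : W.SelmerDualData κ γ),
        ∃ (I : IwasawaH1Data W 2 κ γ) (Z : Submodule (IwasawaAlgebra 2) I.H)
          (P₀ : Type) (_ : AddCommGroup P₀) (_ : Module (IwasawaAlgebra 2) P₀)
          (S : Type) (_ : AddCommGroup S) (ψ : AddMonoid.End S) (toDualP : P₀ →+ (S →+ AddCircle (1 : ℚ)))
          (col : P₀ →ₗ[IwasawaAlgebra 2] IwasawaAlgebra 2) (φ : W.selmerInfty κ →+ S)
          (ℓ₀ : I.H →ₗ[IwasawaAlgebra 2] P₀),
          Z ≤ Submodule.span (IwasawaAlgebra 2) {s : I.H | IsEulerSystemClassTwo W hκ I s} ∧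
          IsDualPair 2 ψ toDualP ∧ Function.Injective col ∧
          (∀ s, φ ((W.conjSelmerInfty κ γ - 1) s) = ψ (φ s)) ∧
          (∀ s : W.selmerInfty κ, φ s = 0 ↔ (s : W.subgroupH1 2 κ.kerSubgroup) ∈ W.fineSelmerInfty κ) ∧
          (∀ z ∈ Z, ∀ s : W.selmerInfty κ, toDualP (ℓ₀ z) (φ s) = 0) ∧
          ∀ G₁ : IwasawaAlgebra 2,
            iwasawaToPowerSeries 2 G₁ = padicLFunction f (unitRoot W 2 : ℚ_[2]) →
              ∃ s : IwasawaAlgebra 2, s ∉ IwasawaAlgebra.augIdealP 2 ∧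
                s * G₁ ∈ Submodule.map (col ∘ₗ ℓ₀) Z) :
    ZetaColemanMuInputsAtTwo := by
  intro W _ _ _ _ _ N _ f κ γ hκ hord h2 hγ hγ' hf D Y
  obtain ⟨I, Z, P₀, instP₀, instP₀', S, instS, ψ, toDualP, col, φ, ℓ₀, hZ, hP, hcol, hφ, hker, hrec,
    himg⟩ := hsupply W f κ γ hκ hord h2 hγ hγ' hf D
  exact hasZetaColemanMuInputsAtTwo_of_localDualPair D Y I Z hZ hP col hcol φ hφ hker ℓ₀ hrec himg

/-- **F1μ⁺ `ZetaColemanMuInputsAtTwo` from the three typed inputs in their natural shape, curve by curve** — for every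
`W` on the sign-free habitat and every Selmer dual datum `D`: a pinned `𝐇¹`, a SET `G` of genuine `2`-adic Euler-system
classes (Kato's `Λ`-adic `(c, d, a(A))`-lifts), (L) a local Coleman dual pair at `2` with injective `col` and `φ = loc₂`
described by its kernel above `2` (F1-Col/F1-Dual), (R) reciprocity on the members of `G` (F1-R), (E) the explicit
reciprocity law at `2` in the shape `col (ℓ₀ g) = u·M̃·L′`, `ι L′ = C ϖ′ · L₂(f, α)`, `‖ϖ′‖₂ = 1`, `M̃ ∉ (2)` (F1-ERLμ; the
multiplier clause is p683151 `katoMultiplier_not_mem_augIdealP_two` for the supplier's `(c, d, a(A))`). Kernel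
implication; the supply is the OPEN content (readings of Kato 17.9/17.11, Λ-adic local duality + Poitou–Tate, 16.6 (2)
AT `p = 2`), nothing asserted. [cite: Kato2004Asterisque, Thm 12.6 (p. 222), Lemma 13.10 (p. 230), (14.9.3) (p. 240), Thm 16.6 (2) (p. 271), Prop 17.11 (p. 277), §17.13 (pp. 279–280)]
[cite: GreenbergLNM1716, §2 Prop 2.1 (p. 72)] -/
theorem zetaColemanMuInputsAtTwo_of_localDualPairs_locTwo_erl
    (hsupply : ∀ (W : WeierstrassCurve ℚ) [W.IsElliptic] [W.IsGloballyMinimal]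
      [ContinuousSMul ℤ_[2] (W.tateModule 2)] [Module.Free ℤ_[2] (W.tateModule 2)]
      [Module.Finite ℤ_[2] (W.tateModule 2)] {N : ℕ} [NeZero N] (f : CuspForm (Gamma0 N) 2)
      (κ : ZpExtension ℚ 2) (γ : absoluteGaloisGroup ℚ) (hκ : κ.IsCyclotomic),
      IsOrdinaryAt W 2 → W.HasSurjectiveModNGaloisRep 2 →
      κ.IsTopGenerator γ → IsCyclotomicVariable 2 γ → IsNewformOf W f →
      ∀ (D : W.SelmerDualData κ γ),
        ∃ (I : IwasawaH1Data W 2 κ γ) (G : Set I.H)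
          (P₀ : Type) (_ : AddCommGroup P₀) (_ : Module (IwasawaAlgebra 2) P₀)
          (S : Type) (_ : AddCommGroup S) (ψ : AddMonoid.End S) (toDualP : P₀ →+ (S →+ AddCircle (1 : ℚ)))
          (col : P₀ →ₗ[IwasawaAlgebra 2] IwasawaAlgebra 2) (φ : W.selmerInfty κ →+ S)
          (ℓ₀ : I.H →ₗ[IwasawaAlgebra 2] P₀),
          (∀ g ∈ G, IsEulerSystemClassTwo W hκ I g) ∧
          IsDualPair 2 ψ toDualP ∧ Function.Injective col ∧
          (∀ s, φ ((W.conjSelmerInfty κ γ - 1) s) = ψ (φ s)) ∧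
          (∀ s : W.selmerInfty κ, φ s = 0 ↔
            ∀ (v : HeightOneSpectrum (𝓞 ℚ)), ((2 : ℕ) : 𝓞 ℚ) ∈ v.asIdeal → ∀ σ : absoluteGaloisGroup ℚ,
              W.conjH1 2 κ.kerSubgroup σ (s : W.subgroupH1 2 κ.kerSubgroup) ∈
                awayKer κ.kerSubgroup (W.geomPrimaryTorsion 2) v) ∧
          (∀ g ∈ G, ∀ s : W.selmerInfty κ, toDualP (ℓ₀ g) (φ s) = 0) ∧
          ∃ g ∈ G, ∃ (u : (IwasawaAlgebra 2)ˣ) (M L' : IwasawaAlgebra 2) (r : ℚ_[2]),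
            M ∉ IwasawaAlgebra.augIdealP 2 ∧ ‖r‖ = 1 ∧
              iwasawaToPowerSeries 2 L' = PowerSeries.C r * padicLFunction f (unitRoot W 2 : ℚ_[2]) ∧
              col (ℓ₀ g) = (u : IwasawaAlgebra 2) * M * L') :
    ZetaColemanMuInputsAtTwo := by
  intro W _ _ _ _ _ N _ f κ γ hκ hord h2 hγ hγ' hf D Y
  obtain ⟨I, G, P₀, instP₀, instP₀', S, instS, ψ, toDualP, col, φ, ℓ₀, hG, hP, hcol, hφ, hφker, hrecG,
    herl⟩ := hsupply W f κ γ hκ hord h2 hγ hγ' hf D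
  exact hasZetaColemanMuInputsAtTwo_of_localDualPair_locTwo_erl D Y I G hG hP col hcol φ hφ hφker ℓ₀ hrecG herl

end Summit.BirchSwinnertonDyer.BirchSwinnertonDyer.Theorems.SteinbergFibreAtTwo

end
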